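import Summits.QuantumFields.BalabanUV.T4Continuum.Spine.NE1p.DressedSmallFieldMixedDifferenceClosedForm
import Summits.QuantumFields.BalabanUV.T4Continuum.Spine.NE1p.DressedSmallFieldMixedDerivativeSplitLocal

/-!
# T⁴ programme, spine estimate NE1′ (node O3b/H2) — THE DECOUPLING EXPANSION RESUMS: `F(𝟙_S) = Σ_{T ⊆ S} Δ_T F` — the COUPLED expression is the
# sum over the sets of ACTIVE cubes of Bałaban's mixed differences with the complement DECOUPLED ((1.10)∕(2.8)'s «Σ_Z Π_{Δ⊂Z} ∫₀¹ ds(Δ) ∂∕∂s(Δ)»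
# structure, for EVERY function of the cube parameters); its analytic forms — Dimock's (summer) CLOSED FORM `Σ_{T⊆S} ∫_{[0,1]^T} ∂_T F` and the
# CONTOUR form `Σ_{T⊆S} ∫ wS·F∘σS d(⨂ μS T)` — and the geometric convergence `‖F(𝟙_S) − F(0)‖ ≤ A·((1 + e^{−(κ₁−1)})^{#S} − 1)` from Lemma 19

Cell `pub-balaban`, sub-cell `t4`, row NE1′ formalisation crew (`t4/formal/NE1p/LEAVES.md` row W⟨next⟩ — own-initiative DICTIONARY follower of the
unit's rows «THE MIXED DIFFERENCE IN CLOSED FORM» and «THE FTC AND THE SPLIT ON PRINT's ANALYTICITY DOMAIN» under typer R-T61 (ii)), unit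
`b2b-balaban-t4-ne1p-formalise-leaf-08` (gen 12).  ADDITIVE — imports `Spine/NE1p/DressedSmallFieldMixedDifferenceClosedForm` (`mixedDiff_insert`,
`mixedDiff_congr_vertices`, `mixedDiff_empty`) + `Spine/NE1p/DressedSmallFieldMixedDerivativeSplitLocal` (`integral_mixedDeriv_cubePt_eq_mixedDiff_local`,
`mixedLetter_rep_of_split_local`, `norm_mixedDiff_le_lemma19`) ONLY (→ W39.1 `mixedDiff`∕`μS`∕`wS`∕`σS`∕`mixedDiff_pair`∕`mixedDiff_zero`∕`mixedDiff_one`,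
W55 `enumS`∕`mem_enumS`∕`enumS_nodup`, W62 `sS`∕`cubePt`, W57 `isOpen_polyBall`∕`analyticOnNhd_inv_four_sub`, the Literature module `Dimock2011to13/PolydiscCauchyBounds`:
`mixedDeriv`, `polydisc`, `setOne`, `unitBox`, `expansionSum`, `apply_setOne_eq_expansionSum` — all BY NAME).  THEOREMS ONLY + two decided `example`s; 0 `def`, 0 `instance`, 0 `def … : Prop`, 0 cite, 0 sorry, 0 `attribute`; nothing upstream restated.

WHY THIS FILE.  [Balaban1988RGII] p. 14 (2.8): «Σ_Z Π_{Δ⊂Z∖Z̃′₀} ∫₀¹ ds(Δ) ∂∕∂s(Δ) · ∫dμ₀(X) G(Z₀, X, C^{(k)}(Z₀, s(Z)), …) = Σ_Z H(Z, Z₀)» — the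
decoupling expansion of ONE coupled expression into a sum over the sets `Z` of active cubes (LOCUS of the audited manuscript, TYPE∕CONTEXT only);
[Dimock2013] §4.5 (summer): «successively in each variable» — whose CLOSED FORM «the sum over B ⊆ l of ∫_{[0,1]^B} ds_B ∂∕∂s_B g|_{s_{l∖B} = 0}» the
cite-tagged Literature module `PolydiscCauchyBounds` declares «not spelled out (it is the unfolding of the recursion)» (its header, reading (iv)).
The lineage has every PIECE of the expansion in kernel — the term (`mixedDiff`, W39.1), its contour letter (W39.1∕W43, W70∕«SplitLocal»), its
derivative form (W55∕W57) and cube integral (W62∕«SplitLocal»), its closed form and bounds («ClosedForm», `norm_mixedDiff_le_lemma19`) — but not the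
IDENTITY THAT MAKES IT AN EXPANSION: that the terms RESUM to the coupled expression.  Here it is, algebraic first, analytic second:
* §1 **`sum_mixedDiff_powerset`: `Σ_{T ∈ 𝒫(S)} Δ_T F = F(𝟙_S)`** for EVERY `F : (Fin n → ℂ) → ℂ` — Möbius inversion on the Boolean cube of the
  active set (Finset induction: `Finset.sum_powerset_insert`, «ClosedForm»'s `mixedDiff_insert`, and `mixedDiff_congr_vertices` for «a set of active
  cubes not containing `j` does not see `z_j ↦ 0`»); **`apply_one_eq_sum_mixedDiff`**: the FULLY COUPLED value `F(1, …, 1) = Σ_{T ⊆ univ} Δ_T F`;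
  **`apply_indicator_sub_apply_zero`**: `F(𝟙_S) − F(0) = Σ_{∅ ≠ T ⊆ S} Δ_T F` — the terms with at least one active cube;
* §2 the ANALYTIC forms, for `F` analytic on the open polydisc `Π_j {|z_j| < R_j}`, `R_j > 1` (print's domain): **`apply_indicator_eq_sum_integral_mixedDeriv`**:
  `F(𝟙_S) = Σ_{T ⊆ S} ∫ ∂_{enumS T} F (cubePt T s) d(⨂ sS T)` — Dimock's (summer) CLOSED FORM as an explicit `Finset` sum of box integrals, in kernel
  («SplitLocal» `integral_mixedDeriv_cubePt_eq_mixedDiff_local` termwise), and **`expansionSum_enumS_zero_eq_sum`**: the template's RECURSIVE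
  `expansionSum (enumS n S) F 0` (its theorem `apply_setOne_eq_expansionSum` BY NAME, once) EQUALS that explicit sum — Dimock's recursion UNFOLDED;
  **`apply_indicator_eq_sum_mixedLetter`**: with contour radii `1 < r_j < R_j`,
  `F(𝟙_S) = Σ_{T ⊆ S} ∫ wS r T·F∘σ_T d(⨂ μS T)` — Bałaban's «Σ_Z Π_{Δ∈Z} ∫₀¹ ds(Δ) (1∕2πi) ∫ dσ(Δ)∕(σ(Δ) − s(Δ))² …» resummation ((2.8)∕(2.14), TYPE)
  in kernel («SplitLocal» `mixedLetter_rep_of_split_local` termwise);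
* §3 **`norm_apply_indicator_sub_apply_zero_le`**: for `1 ≤ κ₁`, `R_j > e^{κ₁}` and `‖F‖ ≤ A` on the closed polydisc `|z_j| ≤ e^{κ₁}` (HYPOTHESIS of
  (1.18)∕(1.21) TYPE), `‖F(𝟙_S) − F(0)‖ ≤ A·((1 + e^{−(κ₁−1)})^{#S} − 1)` — each active cube costs a factor `e^{−(κ₁−1)}` («SplitLocal»
  `norm_mixedDiff_le_lemma19` termwise + the binomial theorem `Finset.sum_pow_mul_eq_add_pow`): the geometric CONVERGENCE MECHANISM of the expansion
  on a decided scale (print's (2.15)∕Lemma 3 combinatorics on the actual polymers is NOT touched);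
* §4 decided `example`s at `n = 2`: `e = F(1,1) = F(0,0) + Δ_{0} + Δ_{1} + Δ_{01} = 1 + 0 + 0 + (e − 1)` for `e^{z₀z₁}` (the two one-cube terms
  vanish — each alone is decoupled), and the same four-term expansion for W57's NON-ENTIRE `(4 − z₀z₁)⁻¹`: `1∕3 = 1∕4 + 0 + 0 + 1∕12`.

HONEST FRAMING.  [folklore] finite combinatorics (Möbius inversion on the Boolean cube, the binomial theorem) + the lineage's kernel analysis BY NAME,
on OUR dictionary objects and the template's kernel object `PolydiscCauchyBounds.mixedDeriv`; a DICTIONARY row — the expansion IDENTITY and its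
convergence mechanism on a decided scale, not an estimate of print: `F` ↔ print's coupled expression ((1.10)∕(2.7)∕(2.8)'s integrand as a function of
the s(Δ)) is a TYPE READING; `A` is a hypothesis of printed TYPE; no numeral of [Balaban1988RGII] asserted (k2); nothing of (2.15)'s polymer
combinatorics, Lemma 3, (2.38)–(2.41) is reproduced; (B1) for Bałaban's (2.14) NOT discharged; (B3) = GAPS G-ne9p2-5 UNPRINTED — NOT discharged,
untouched; (B5) untouched; 0 binders instantiated on Bałaban's densities ∕ operators ∕ (2.14) data ∕ `d_k` ∕ minimisers ∕ backgrounds; discharges no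
wall item; wall v1.8 (T4-DAG v48) does NOT move; R-t4r2-Q2 NOT met thereby; NE1′ ⇐ the named binders — NOT proved, NOT printed; spine PROVED 0∕9;
count 9 unchanged.  Rung (B)+1 on ONE finite four-torus — NOT infinite volume, NOT a mass gap, NOT OS on ℝ⁴, NOT Clay.  ABSOLUTE RULE honoured: the
quotation is a LOCUS of the audited manuscript [Balaban1988RGII] (CMP 116 (1988) 1–22, p. 14), TYPE∕CONTEXT only, never a hypothesis-free fact;
[Dimock2013] enters only through the cite-tagged Literature module BY NAME (its own header's «not spelled out» is quoted as the module's text, not as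
print); nothing internally minted is cited; [folklore] tags on kernel lemmas only.  HONEST DEPENDENCY: continuum YM on T⁴ ⇐ BetaPertH ∧ nine spine
estimates (0/9 proved); BetaPertH ⇐ (D1) ∧ (D4) ∧ CAP+tail; G-an2-4 gates asym, D1 and NE2/3/4.
-/

noncomputable section

namespace Summit.QuantumFields.BalabanUV.T4Continuum.NE1p.DressedSmallFieldDecouplingExpansion

open MeasureTheory Metric Finset Function
open Summit.QuantumFields.BalabanUV.T4Continuum.NE1p.DressedSmallFieldMixedLetter
open Summit.QuantumFields.BalabanUV.T4Continuum.NE1p.DressedSmallFieldMixedDerivativeBridge (enumS mem_enumS enumS_nodup analyticOnNhd_apply)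
open Summit.QuantumFields.BalabanUV.T4Continuum.NE1p.DressedSmallFieldMixedDerivativeFTC (sS cubePt)
open Summit.QuantumFields.BalabanUV.T4Continuum.NE1p.DressedSmallFieldMixedDerivativeLetterLocal (isOpen_polyBall analyticOnNhd_inv_four_sub)
open Summit.QuantumFields.BalabanUV.T4Continuum.NE1p.DressedSmallFieldMixedDerivativeSplitLocal
open Summit.QuantumFields.BalabanUV.T4Continuum.NE1p.DressedSmallFieldMixedDifferenceClosedForm
open Literature.MathematicalPhysics.QuantumFieldTheory.Dimock2011to13.PolydiscCauchyBounds
  (mixedDeriv polydisc setOne unitBox expansionSum apply_setOne_eq_expansionSum)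

variable {n : ℕ}

/-! ## §1 THE DECOUPLING EXPANSION RESUMS: `Σ_{T ⊆ S} Δ_T F = F(𝟙_S)` for every `F` -/

/-- [folklore] A set of active cubes NOT containing `j` does not see the update `z_j ↦ 0`: `Δ_T (z ↦ F(z[j ↦ 0])) = Δ_T F` for `j ∉ T` («ClosedForm»
`mixedDiff_congr_vertices`: every vertex `𝟙_U`, `U ⊆ T`, already has `z_j = 0`). -/
theorem mixedDiff_update_zero_of_notMem {j : Fin n} {T : Finset (Fin n)} (hj : j ∉ T) (F : (Fin n → ℂ) → ℂ) :
    mixedDiff n T (fun z => F (update z j 0)) = mixedDiff n T F :=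
  mixedDiff_congr_vertices fun U hU => by
    have hjU : j ∉ U := fun h => hj (mem_powerset.1 hU h)
    rw [update_indicator_zero hjU]

/-- **THE DECOUPLING EXPANSION RESUMS TO THE COUPLED EXPRESSION** [folklore] (Möbius inversion on the Boolean cube of the active set; Finset induction
through Mathlib `Finset.sum_powerset_insert`, «ClosedForm» `mixedDiff_insert` and `mixedDiff_update_zero_of_notMem`): for EVERY function `F` of the
cube parameters and every set `S` of cubes, `Σ_{T ∈ 𝒫(S)} Δ_T F = F(𝟙_S)` — the value with the cubes of `S` COUPLED (`z = 1` on `S`, `0` off `S`) is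
the sum, over the subsets `T ⊆ S` of ACTIVE cubes, of Bałaban's mixed differences with the complement DECOUPLED: the structure of (1.10)∕(2.8)'s
«Σ_Z Π_{Δ⊂Z} ∫₀¹ ds(Δ) ∂∕∂s(Δ) [one expression]» (p. 14, TYPE), with no analyticity and no integral. -/
theorem sum_mixedDiff_powerset (S : Finset (Fin n)) (F : (Fin n → ℂ) → ℂ) :
    ∑ T ∈ S.powerset, mixedDiff n T F = F (fun i => if i ∈ S then (1 : ℂ) else 0) := by
  induction S using Finset.induction_on generalizing F with
  | empty =>
      rw [powerset_empty, sum_singleton, mixedDiff_empty]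
      exact congrArg F (funext fun i => by simp)
  | @insert j S hj ih =>
      rw [sum_powerset_insert hj]
      have hins : ∀ T ∈ S.powerset, mixedDiff n (insert j T) F =
          mixedDiff n T (fun z => F (update z j 1)) - mixedDiff n T F := fun T hT => by
        have hjT : j ∉ T := fun h => hj (mem_powerset.1 hT h)
        rw [mixedDiff_insert n j T F hjT, mixedDiff_update_zero_of_notMem hjT]
      rw [sum_congr rfl hins, sum_sub_distrib, add_sub_cancel, ih (fun z => F (update z j 1))]
      exact congrArg F (update_indicator_one hj)

/-- **THE FULLY COUPLED VALUE** [folklore] (§1 at `S = univ`): `F(1, …, 1) = Σ_{T ⊆ univ} Δ_T F` — every set of cubes `Z` contributes the term with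
exactly the cubes of `Z` active and all others decoupled ((2.8)'s «Σ_Z», TYPE). -/
theorem apply_one_eq_sum_mixedDiff (F : (Fin n → ℂ) → ℂ) :
    F (fun _ => 1) = ∑ T ∈ (Finset.univ : Finset (Fin n)).powerset, mixedDiff n T F := by
  rw [sum_mixedDiff_powerset]; simp

/-- **THE TERMS WITH AT LEAST ONE ACTIVE CUBE** [folklore] (§1 minus the `T = ∅` term `Δ_∅ F = F(0)`, «ClosedForm» `mixedDiff_empty`):
`F(𝟙_S) − F(0) = Σ_{T ∈ 𝒫(S) ∖ {∅}} Δ_T F`. -/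
theorem apply_indicator_sub_apply_zero (S : Finset (Fin n)) (F : (Fin n → ℂ) → ℂ) :
    F (fun i => if i ∈ S then (1 : ℂ) else 0) - F 0 = ∑ T ∈ S.powerset.erase ∅, mixedDiff n T F := by
  rw [← sum_mixedDiff_powerset S F, ← add_sum_erase _ _ (empty_mem_powerset S), mixedDiff_empty, add_sub_cancel_left]

/-! ## §2 The ANALYTIC forms of the expansion on print's domain: Dimock's (summer) closed form and Bałaban's contour form -/

/-- **DIMOCK's (summer) CLOSED FORM, IN KERNEL** (§1 + «SplitLocal» `integral_mixedDeriv_cubePt_eq_mixedDiff_local` termwise): for `F` analytic on the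
open polydisc `Π_j {|z_j| < R_j}`, `R_j > 1`, `F(𝟙_S) = Σ_{T ∈ 𝒫(S)} ∫ ∂_{enumS T} F (cubePt T s) d(⨂_j sS T j)(s)` — «the sum over B ⊆ l of
∫_{[0,1]^B} ds_B ∂∕∂s_B g|_{s_{l∖B} = 0}» as an explicit `Finset` sum of box integrals of the template's `mixedDeriv` (the form the cite-tagged module
`PolydiscCauchyBounds` gives only as the recursion `expansionSum`; nothing of that module is restated — its object is USED). [folklore] -/
theorem apply_indicator_eq_sum_integral_mixedDeriv {R : Fin n → ℝ} (hR1 : ∀ j, 1 < R j) (S : Finset (Fin n)) (F : (Fin n → ℂ) → ℂ)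
    (hF : AnalyticOnNhd ℂ F (Set.univ.pi fun j => ball (0 : ℂ) (R j))) :
    F (fun i => if i ∈ S then (1 : ℂ) else 0) =
      ∑ T ∈ S.powerset, ∫ s, mixedDeriv (enumS n T) F (cubePt T s) ∂(Measure.pi (sS T)) := by
  rw [← sum_mixedDiff_powerset S F]
  exact sum_congr rfl fun T _ => (integral_mixedDeriv_cubePt_eq_mixedDiff_local n R T F hR1 hF).symm

/-- [folklore] The template's unit box over the enumerated active cubes, based at the decoupled point `0`, lies inside the open polydisc of radii `> 1`. -/
theorem unitBox_enumS_zero_subset {R : Fin n → ℝ} (hR1 : ∀ j, 1 < R j) (S : Finset (Fin n)) :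
    unitBox (enumS n S) (0 : Fin n → ℂ) ⊆ Set.univ.pi fun j => ball (0 : ℂ) (R j) := by
  intro p hp
  refine Set.mem_univ_pi.2 fun j => mem_ball_zero_iff.2 ?_
  by_cases hj : j ∈ enumS n S
  · obtain ⟨t, ht, hpt⟩ := hp.2 j hj
    rw [hpt, Complex.norm_real, Real.norm_of_nonneg ht.1]
    exact lt_of_le_of_lt ht.2 (hR1 j)
  · rw [hp.1 j hj]; simpa using zero_lt_one.trans (hR1 j)

/-- [folklore] Setting the enumerated active cubes to `1` at the decoupled base point gives the vertex `𝟙_S` (W55 `mem_enumS`). -/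
theorem setOne_enumS_zero (S : Finset (Fin n)) : setOne (enumS n S) (0 : Fin n → ℂ) = fun i => if i ∈ S then (1 : ℂ) else 0 := by
  funext i; simp [setOne, mem_enumS]

/-- **DIMOCK's RECURSION UNFOLDED** (the cite-tagged Literature theorem `apply_setOne_eq_expansionSum` — (summer) in its RECURSIVE form — BY NAME, once,
+ `apply_indicator_eq_sum_integral_mixedDeriv`): for `F` analytic on the open polydisc `Π_j {|z_j| < R_j}`, `R_j > 1`, the template's recursive
`expansionSum (enumS n S) F 0` EQUALS the explicit `Finset` sum `Σ_{T ∈ 𝒫(S)} ∫ ∂_{enumS T} F (cubePt T s) d(⨂ sS T)` — «the sum over B ⊆ l of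
∫_{[0,1]^B} ds_B ∂∕∂s_B g|_{s_{l∖B} = 0}» which `PolydiscCauchyBounds`' header (reading (iv)) leaves «not spelled out»; both sides are `F(𝟙_S)`.  Nothing
of the Literature module is restated: its `expansionSum`∕`setOne`∕`unitBox` are USED at `l := enumS n S`, `s := 0`. [folklore] -/
theorem expansionSum_enumS_zero_eq_sum {R : Fin n → ℝ} (hR1 : ∀ j, 1 < R j) (S : Finset (Fin n)) (F : (Fin n → ℂ) → ℂ)
    (hF : AnalyticOnNhd ℂ F (Set.univ.pi fun j => ball (0 : ℂ) (R j))) :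
    expansionSum (enumS n S) F 0 = ∑ T ∈ S.powerset, ∫ s, mixedDeriv (enumS n T) F (cubePt T s) ∂(Measure.pi (sS T)) := by
  rw [← apply_setOne_eq_expansionSum (isOpen_polyBall R) (enumS n S) (enumS_nodup n S) F hF 0 (unitBox_enumS_zero_subset hR1 S),
    setOne_enumS_zero]
  exact apply_indicator_eq_sum_integral_mixedDeriv hR1 S F hF

/-- **BAŁABAN's CONTOUR FORM OF THE EXPANSION, IN KERNEL** (§1 + «SplitLocal» `mixedLetter_rep_of_split_local` termwise): for `F` analytic on the open
polydisc `Π_j {|z_j| < R_j}` and contour radii `1 < r_j < R_j`, `F(𝟙_S) = Σ_{T ∈ 𝒫(S)} ∫ wS r T p · F(σ_T(p)) d(⨂_j μS T j)(p)` — «Σ_Z Π_{Δ∈Z} ∫₀¹ ds(Δ)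
(1∕2πi) ∫ dσ(Δ)∕(σ(Δ) − s(Δ))² [the expression at σ on Z, decoupled off Z]» ((2.8) with (2.14)'s cube letters, p. 14∕15, TYPE): the coupled value
is RECOVERED from the contour letters of all active sets. [folklore] -/
theorem apply_indicator_eq_sum_mixedLetter {r R : Fin n → ℝ} (hr : ∀ j, 1 < r j) (hR : ∀ j, r j < R j) (S : Finset (Fin n))
    (F : (Fin n → ℂ) → ℂ) (hF : AnalyticOnNhd ℂ F (Set.univ.pi fun j => ball (0 : ℂ) (R j))) :
    F (fun i => if i ∈ S then (1 : ℂ) else 0) = ∑ T ∈ S.powerset, ∫ p, wS r T p * F (σS r T p) ∂(Measure.pi (μS T)) := by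
  rw [← sum_mixedDiff_powerset S F]
  exact sum_congr rfl fun T _ => (mixedLetter_rep_of_split_local hr hR T F hF).symm

/-! ## §3 Geometric convergence: each active cube costs `e^{−(κ₁−1)}` -/

/-- **`‖F(𝟙_S) − F(0)‖ ≤ A·((1 + e^{−(κ₁−1)})^{#S} − 1)`** [folklore] (§1 `apply_indicator_sub_apply_zero` + «SplitLocal» `norm_mixedDiff_le_lemma19`
termwise + the binomial theorem `Finset.sum_pow_mul_eq_add_pow`): for `1 ≤ κ₁`, `F` analytic on an open polydisc of radii `R_j > e^{κ₁}` and bounded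
by `A` on the closed polydisc `|z_j| ≤ e^{κ₁}` (a HYPOTHESIS of (1.18)∕(1.21) TYPE), the sum of ALL terms with at least one active cube is at most
`A·Σ_{∅≠T⊆S} e^{−(κ₁−1)·#T} = A·((1 + e^{−(κ₁−1)})^{#S} − 1)` — the expansion's terms decay GEOMETRICALLY in the number of active cubes: the
convergence MECHANISM of (2.8)∕(2.15) on a decided scale (print's polymer combinatorics and Lemma 3 are NOT reproduced). -/
theorem norm_apply_indicator_sub_apply_zero_le {R : Fin n → ℝ} {κ₁ A : ℝ} (hκ : 1 ≤ κ₁) (hR : ∀ j, Real.exp κ₁ < R j)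
    (S : Finset (Fin n)) {F : (Fin n → ℂ) → ℂ} (hF : AnalyticOnNhd ℂ F (Set.univ.pi fun j => ball (0 : ℂ) (R j)))
    (hA : ∀ z ∈ polydisc (fun _ : Fin n => Real.exp κ₁), ‖F z‖ ≤ A) :
    ‖F (fun i => if i ∈ S then (1 : ℂ) else 0) - F 0‖ ≤ A * ((1 + Real.exp (-(κ₁ - 1))) ^ S.card - 1) := by
  have hA0 : 0 ≤ A := (norm_nonneg _).trans (hA 0 fun _ => by simpa using (Real.exp_pos κ₁).le)
  have hterm : ∀ T ∈ S.powerset.erase ∅, ‖mixedDiff n T F‖ ≤ A * Real.exp (-(κ₁ - 1)) ^ T.card := fun T _ => by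
    have h := norm_mixedDiff_le_lemma19 hκ hR T hF hA
    rwa [show -((κ₁ - 1) * (T.card : ℝ)) = (T.card : ℝ) * (-(κ₁ - 1)) by ring, Real.exp_nat_mul] at h
  -- the binomial sum over ALL subsets, then remove the empty one
  have hbin : ∑ T ∈ S.powerset, A * Real.exp (-(κ₁ - 1)) ^ T.card = A * (1 + Real.exp (-(κ₁ - 1))) ^ S.card := by
    rw [← mul_sum, add_comm, ← sum_pow_mul_eq_add_pow (Real.exp (-(κ₁ - 1))) (1 : ℝ) S]
    simp
  have hsplit : ∑ T ∈ S.powerset.erase ∅, A * Real.exp (-(κ₁ - 1)) ^ T.card = A * ((1 + Real.exp (-(κ₁ - 1))) ^ S.card - 1) := by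
    have h := add_sum_erase S.powerset (fun T => A * Real.exp (-(κ₁ - 1)) ^ T.card) (empty_mem_powerset S)
    rw [hbin, card_empty, pow_zero, mul_one] at h
    linarith
  rw [apply_indicator_sub_apply_zero]
  calc ‖∑ T ∈ S.powerset.erase ∅, mixedDiff n T F‖ ≤ ∑ T ∈ S.powerset.erase ∅, ‖mixedDiff n T F‖ := norm_sum_le _ _
    _ ≤ ∑ T ∈ S.powerset.erase ∅, A * Real.exp (-(κ₁ - 1)) ^ T.card := sum_le_sum hterm
    _ = A * ((1 + Real.exp (-(κ₁ - 1))) ^ S.card - 1) := hsplit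

/-! ## §4 Decided checks at `n = 2` -/

/-- DECIDED CHECK (the expansion of `e^{z₀z₁}` at `S = {0,1}`): `e = F(1,1) = Δ_∅ + Δ_{0} + Δ_{1} + Δ_{01} = 1 + 0 + 0 + (e − 1)` — the two ONE-cube terms
VANISH (with the other cube decoupled the factor does not see the active one), the whole coupling sits in the two-cube term (§1 + W39.1's faces). -/
example : (∑ T ∈ ({0, 1} : Finset (Fin 2)).powerset, mixedDiff 2 T fun z : Fin 2 → ℂ => Complex.exp (z 0 * z 1)) = Complex.exp 1 := by
  rw [sum_mixedDiff_powerset]; simp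

/-- DECIDED CHECK (the same four-term expansion for W57's NON-ENTIRE `(4 − z₀z₁)⁻¹`, each term through its CONTOUR letter at radii `3∕2 < 2` by §2):
`Σ_{T ⊆ {0,1}} ∫ wS·(4 − σ₀σ₁)⁻¹ d(⨂ μS T) = F(1,1) = 1∕3` (`= 1∕4 + 0 + 0 + 1∕12`). -/
example : (∑ T ∈ ({0, 1} : Finset (Fin 2)).powerset, ∫ p : Fin 2 → ℝ × ℝ, wS (fun _ => (3 / 2 : ℝ)) T p *
    (4 - σS (fun _ => (3 / 2 : ℝ)) T p 0 * σS (fun _ => (3 / 2 : ℝ)) T p 1)⁻¹ ∂(Measure.pi (μS T))) = 1 / 3 := by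
  rw [← apply_indicator_eq_sum_mixedLetter (n := 2) (R := fun _ => 2) (fun _ => by norm_num) (fun _ => by norm_num) {0, 1}
    (fun z : Fin 2 → ℂ => (4 - z 0 * z 1)⁻¹) analyticOnNhd_inv_four_sub]
  norm_num

end Summit.QuantumFields.BalabanUV.T4Continuum.NE1p.DressedSmallFieldDecouplingExpansion

end
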